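/-
Copyright (c) 2026 the pub-hodgecm-mathlib formalisation cell (harness21).  Prover seat hodgecm-mathlib-LH4-p11 (g3), req620 Track A «(D-RAM) FOUR-FRAME» squad
(unit U3_Laws, (KMS) road «MODULO κ-STAGE B», dealer LH4-plan (g11) WORD #56 (b) ∕ LH4-plan (g12) WORD #4: THE (κ-B₂) CHILD `stub_U3_kappaCount_typeTwo_mult`
(tree `Cruxes/H413/Lines/F0_P3c_DyRamFourFrame_U3_Laws.lean` ED. 10 :498) PAID — the payer-modulo-box-sum (this seat, ★ p856967) fed this seat's ★ κ-BOX-SUM₂ identity (p856964)).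
The tv-2 twin of F0P3a-p01 (g32)'s ★ `F0P3cDyRamKappaCountTypeZeroPaid`.  2026-09-04.
-/
import Summits.HodgeConjecture.HodgeConjecture.Theorems.F0P3cDyRamKappaCountTypeTwo      -- ★ p856967 (this seat): `kappaCount_typeTwo_mult_of_boxSum` — (κ-B₂) modulo the box-sum identity; brings every ★ type-2 κ-socket
import Summits.HodgeConjecture.HodgeConjecture.Theorems.F0P3cDyRamKappaCountBoxSumTwo   -- ★ p856964 (this seat): `sum_box_kappa_eq_typeTwo` — «κ-BOX-SUM₂», the finite-sum arithmetic of the type-2 κ-table over the box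
import HarnessLib

/-!
# Crux `H413`, line LH4 «(D-RAM) FOUR-FRAME» road — unit U3_Laws (iii), (KMS) road «MODULO κ-STAGE B»: THE (κ-B₂) CHILD PAID —
# `|Σᶠ_{M ∈ 𝓛₀(T), type-2-polarisable} κ₂,ᵢ(M)·w(M)| = ampl(q, k, B + τ(d))∕4`, unconditionally

Cell `hodgecm-mathlib` (D-0151), FLOOR 0, crux item H413 = `stmt-HodgeConjecture-24833`, route of record `HCCMUnconditional`; squad F0∕P3c∕LH4 (req618∕req620); registered stub served:
`F0P3cDyRamFourFrameU3.stub_U3_kappaCount_typeTwo_mult` ((κ-B₂), U3 ED. 10 :498 — the `hBκ10₂` binder of ★ Fκ5 ED. 2 `kappaModelSum_of_kappaStageB_complete`).  THEOREMS ONLY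
(no `def`, no instance, no notation, no `sorry`, default heartbeats); lane `--supports stmt-HodgeConjecture-24833 --as helper` (count-neutral).  ONE theorem, whose TYPE is the (κ-B₂)
sentence TOKEN FOR TOKEN (`[CompleteSpace K]`, `depthOfRecord d`, `shiftR d t`, `tauOfRecord d`, `ampl`), proved by ONE application: this seat's ★ `kappaCount_typeTwo_mult_of_boxSum`
(★ LH4-p10 (g3) measure-side split into type-2 strata, the seven ★ type-2 κ-sockets T₂ p856737 (F0P3a-p01 (g32)) ∕ G1₂ `…GluedSocketTwoZero` (F0P3-p01 (g31)) ∕ G2₂–G3₂ p856915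
(LH4-p13 (g3)) ∕ H₂ `…CoreHangingTwoSocket` (LH4-p08 (g3)) at σ-fixed glue witnesses ★ `KappaAssemblyTools` (F0P3a-p01 (g32)), `0` off the ★ B3₂-γ shape list, `|sign token| = 1`,
`max(0, q^k − q^{k−(B+τ)}) = q^k − q^{k−B₂}`) fed this seat's ★ «κ-BOX-SUM₂» `F0P3cDyRamKappaCountBoxSumTwo.sum_box_kappa_eq_typeTwo` (on-branch block + tube rows telescope, the
glue cells tile the top powers `[k − B₂, k − 1]` with one sign).  So the U3 pay line of the next edition is the single token
`Summit.HodgeConjecture.HodgeConjecture.Cruxes.H413.F0P3cDyRamKappaCountTypeTwoPaid.kappaCount_typeTwo_mult`.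
HONEST LABEL.  Count-neutral (`--supports`); this settles the UNSIGNED type-2 κ-census child of U3 only — with ★ `KappaCountTypeZeroPaid` the parent (KMS) `stub_U3_kappaModelSum`
and `stub_U3_kappaAbsLawR` become sorry-free by composition in the next U3 edition; the signed κS leaves (under the (R-22) re-lettering) remain PROVER TARGETS; nothing printed is
asserted; `HC_CM` is proved only modulo the 7 printed citations (2 remaining named inputs: hLiu418 = `stmt-HodgeConjecture-24832`, h413 = `stmt-HodgeConjecture-24833`) until rung 0 closes.

## References
* [Kottwitz1986BaseChangeUnits] R. E. Kottwitz, *Base change for unit elements of Hecke algebras*, Compositio Math. 60 (1986), §1 pp. 240–241 (κ-orbital integrals of units as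
  signed lattice counts modulo the torus).
* [Rogawski1990] J. D. Rogawski, *Automorphic Representations of Unitary Groups in Three Variables*, Ann. of Math. Stud. 123 (1990), §4.9 Prop. 4.9.1 (b) p. 55, §4.10 p. 58.
* [LanglandsShelstad1987] R. P. Langlands, D. Shelstad, *On the definition of transfer factors*, Math. Ann. 278 (1987), §3 (κ as a character of `H¹(F, T)`).
-/

set_option autoImplicit false

noncomputable section

namespace Summit.HodgeConjecture.HodgeConjecture.Cruxes.H413.F0P3cDyRamKappaCountTypeTwoPaid

open Literature.NumberTheory.Automorphic Literature.NumberTheory.Automorphic.HermitianLattice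
open Literature.NumberTheory.Automorphic.UnitaryLatticeTree Literature.NumberTheory.Automorphic.UnitaryThreeFourFrame
open Literature.NumberTheory.LocalFields Literature.NumberTheory.LocalFields.WildQuadraticDatum
open Summit.HodgeConjecture.HodgeConjecture.Cruxes.H413.F0P3cDyRamFourFrameLawDefsR (shiftR)
open Summit.HodgeConjecture.HodgeConjecture.Cruxes.H413.F0P3cDyRamDiagonalTorusDefs
open Summit.HodgeConjecture.HodgeConjecture.Cruxes.H413.F0P3cDyRamDiagonalStrataDefs
open Summit.HodgeConjecture.HodgeConjecture.Cruxes.H413.F0P3cDyRamDiagonalKappaCountDefs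
open Summit.HodgeConjecture.HodgeConjecture.Cruxes.H413.F0P3cDyRamKappaCountTypeTwo (kappaCount_typeTwo_mult_of_boxSum)
open Summit.HodgeConjecture.HodgeConjecture.Cruxes.H413.F0P3cDyRamKappaCountBoxSumTwo (sum_box_kappa_eq_typeTwo)
open scoped Valued WithZero Matrix MatrixGroups

/-! ## §1  The (κ-B₂) child, unconditionally -/

/-- **(κ-B₂) «TYPE 2, UNSIGNED, WITH MULTIPLICITY» — THE κ-WEIGHTED TYPE-2 CENSUS LAW OF THE DIAGONAL MODEL.**  For every wild ramified quadratic datum on a complete field with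
finite residue field (`|2| < 1`), every element datum `(α, β; n₁, n₂, n₃)` at the depth of record, `T = diag(α, β, 1)`, `2k + d = n₁ + n₂ + n₃ + 2`, every slot `i` and
`2B = nᵢ − d + 2 − 2·shiftR d t`: `|Σᶠ_{M ∈ 𝓛₀(T), type-2-polarisable} κ₂,ᵢ(M)·w(M)| = ampl(q, k, B + τ(d))∕4` — the sentence of `stub_U3_kappaCount_typeTwo_mult` (U3 ED. 10 :498)
TOKEN FOR TOKEN, by this seat's ★ `kappaCount_typeTwo_mult_of_boxSum` at this seat's ★ `sum_box_kappa_eq_typeTwo`.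
[cite: Kottwitz1986BaseChangeUnits, §1 pp. 240–241] [cite: Rogawski1990, §4.9 Prop. 4.9.1 (b) p. 55; §4.10 p. 58] [cite: LanglandsShelstad1987, §3] -/
theorem kappaCount_typeTwo_mult :
    ∀ {K : Type} [Field K] [Valued K ℤᵐ⁰] [CompleteSpace K] [Fintype 𝓀[K]] {σ : K →+* K} {ϖ : K} {d t : ℕ}, IsRamifiedQuadraticDatum σ ϖ d t →
      Valued.v (2 : K) < 1 → ∀ {α β : K} {n₁ n₂ n₃ : ℕ}, IsElementDatum σ ϖ (depthOfRecord d) α β n₁ n₂ n₃ →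
      ∀ (T : GL (Fin 3) K), (T : Matrix (Fin 3) (Fin 3) K) = Matrix.diagonal ![α, β, 1] → ∀ (k : ℕ), 2 * k + d = n₁ + n₂ + n₃ + 2 →
      ∀ (i : Fin 3) (B : ℤ), 2 * B = ((![n₁, n₂, n₃] : Fin 3 → ℕ) i : ℤ) - d + 2 - 2 * shiftR d t →
        |∑ᶠ M ∈ {M : Submodule 𝒪[K] (Fin 3 → K) | M ∈ normalisedStableLattices T ∧ IsTypeTwoPolarisable σ ϖ M},
            (kappaCount σ ϖ 2 i M : ℚ) * stabiliserWeight σ M| = ampl (Fintype.card 𝓀[K]) k (B + tauOfRecord d) / 4 :=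
  kappaCount_typeTwo_mult_of_boxSum sum_box_kappa_eq_typeTwo

end Summit.HodgeConjecture.HodgeConjecture.Cruxes.H413.F0P3cDyRamKappaCountTypeTwoPaid

end
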